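import Mathlib
import Literature.Probability.Percolation.DiagonalStripSumRecursion
import Literature.Probability.Percolation.DiagonalStripSumNonvanishing
import HarnessLib

/-!
# The recursion scalar of IP12 (25) vanishes on the wheel hyperplanes `z_j = q² z_1`

Topic `Literature/Probability/Percolation`. Ikhlef–Ponsaing (J. Stat. Phys. 149 (2012),
arXiv:1202.5476) eq. (25) states `Ψ_L|_{z_2 = q z_1} = (-1)^L ∏_{j ≥ 3} k(z_1, z_j) · φ_1 Ψ_{L-2}(ẑ)`;
the scalar `∏ k(z_1, z_j)` is pinned there through the explicit nested component of §3.5. Here we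
obtain its ZEROS `z_j = q² z_1` (`3 ≤ j ≤ L`) without any explicit component, for the polynomial
`t`-fixed vector `P` (numerator `η_1(P_k)`, denominator `Φ_k` free of `X_1, X_2`, see
`DiagonalStripSumRecursion`):

* `aeval_wheel_eq_substHom_comp_hypSubst` — the wheel substitution is `E_j ∘ η_1`, `E_j : X_j ↦ q² X_1`;
* `substHom_comp_hatRename_one_injective` — `E_j ∘ ẑ_1` is injective;
* `prod_X_sub_dvd_of_substHom_eq_zero` — peeling distinct linear factors `X_j - g`;
* **`substHom_wheel_hypSubst_eq_zero`** — `E_j η_1(P_k) = 0` for every component `k` and every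
  `3 ≤ j ≤ L` such that `Σ_Q P_Q` is `(3 j)`-invariant (from the summed recursion, the wheel zero of
  the sum and `Σ P'' ≠ 0`);
* **`prod_wheel_dvd_hypSubst`** — hence `∏_{j=3}^{L} (X_j - q² X_1) ∣ η_1(P_k)`.

Together with the joint-degree statement (DEG) this pins the `z_1`-dependence of the recursion
scalar, which is the route to Prop. 3.4 (`Z_L = χ_L(z²)`) followed in this development.

## References

* Y. Ikhlef, A. K. Ponsaing, *Finite-size left-passage probability in percolation*, J. Stat. Phys.
  149 (2012) 10–36, arXiv:1202.5476, §3.4 (25), §3.6 (26)–(27), Prop. 3.4. [IkhlefPonsaing2012]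
-/

namespace Literature.Probability.Percolation

open Finset Literature.Probability.LatticeModels Literature.Probability.LatticeModels.TemperleyLieb

/-! ### The recursion scalar vanishes on the wheel hyperplanes `z_j = q² z_1` -/

section ScalarRoots

open MvPolynomial

variable {n : ℕ}

/-- The wheel substitution `X_2 ↦ q X_1, X_j ↦ q² X_1` factors as `E_j ∘ η_1` with
`E_j = substHom j (q² X_1)` (`j ≥ 3`). [folklore] -/
theorem aeval_wheel_eq_substHom_comp_hypSubst (q : ℂ) {j : ℕ} (hj : 3 ≤ j) :
    (aeval (R := ℂ) fun k : ℕ => if k = 2 then C q * X 1 else if k = j then C (q ^ 2) * X 1 else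
        (X k : MvPolynomial ℕ ℂ)).toRingHom =
      (substHom j (C (q ^ 2) * X 1)).toRingHom.comp (hypSubst q 1) := by
  refine ringHom_ext (fun c => ?_) (fun k => ?_)
  · simp only [AlgHom.toRingHom_eq_coe, RingHom.coe_coe, RingHom.comp_apply, hypSubst_C, algHom_C,
      algebraMap_eq]
  · simp only [AlgHom.toRingHom_eq_coe, RingHom.coe_coe, RingHom.comp_apply, aeval_X]
    by_cases hk2 : k = 2
    · subst hk2
      rw [if_pos rfl, show (2 : ℕ) = 1 + 1 from rfl, hypSubst_X_self, map_mul, substHom_C,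
        substHom_X_of_ne _ (show (1 : ℕ) ≠ j by omega)]
    rw [if_neg hk2]
    by_cases hkj : k = j
    · subst hkj
      rw [if_pos rfl, hypSubst_X_of_ne q (show k ≠ 1 + 1 by omega), substHom_X_self]
    · rw [if_neg hkj, hypSubst_X_of_ne q (show k ≠ 1 + 1 by omega), substHom_X_of_ne _ hkj]

/-- `E_j ∘ ẑ_1` is injective (`X_0 ↦ X_0`, `X_{j-2} ↦ q² X_1`, `X_k ↦ X_{k+2}` otherwise). [folklore] -/
theorem substHom_comp_hatRename_one_injective {q : ℂ} (hq0 : q ≠ 0) {j : ℕ} (hj : 3 ≤ j) :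
    Function.Injective ((substHom j (C (q ^ 2) * X 1)).toRingHom.comp (hatRename (K₀ := ℂ) 1)) := by
  let L : MvPolynomial ℕ ℂ →+* MvPolynomial ℕ ℂ :=
    (aeval (R := ℂ) fun i : ℕ => if i = 0 then X 0 else if i = 1 then C (q ^ 2)⁻¹ * X (j - 2) else
      if i = 2 ∨ i = j then 0 else X (i - 2)).toRingHom
  have hLC : ∀ a, L (C a) = C a := fun a => by simp [L]
  have hLX : ∀ i, L (X i) = (if i = 0 then X 0 else if i = 1 then C (q ^ 2)⁻¹ * X (j - 2) else
      if i = 2 ∨ i = j then 0 else X (i - 2)) := fun i => by simp [L]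
  have hleft : L.comp ((substHom j (C (q ^ 2) * X 1)).toRingHom.comp (hatRename 1)) = RingHom.id _ := by
    refine ringHom_ext (fun a => by simp only [RingHom.comp_apply, hatRename_C, AlgHom.toRingHom_eq_coe,
      RingHom.coe_coe, substHom_C, hLC, RingHom.id_apply]) (fun k => ?_)
    simp only [RingHom.comp_apply, hatRename_X, RingHom.id_apply, AlgHom.toRingHom_eq_coe, RingHom.coe_coe]
    by_cases hk0 : k = 0
    · subst hk0
      rw [if_pos (by omega), substHom_X_of_ne _ (show (0 : ℕ) ≠ j by omega), hLX, if_pos rfl]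
    rw [if_neg (by omega)]
    by_cases hkj : k + 2 = j
    · rw [hkj, substHom_X_self, map_mul, hLC, hLX, if_neg (by omega), if_pos rfl, ← mul_assoc, ← map_mul,
        mul_inv_cancel₀ (pow_ne_zero 2 hq0), C_1, one_mul]
      congr 1; omega
    · rw [substHom_X_of_ne _ hkj, hLX, if_neg (by omega), if_neg (by omega), if_neg (by omega), Nat.add_sub_cancel]
  refine Function.LeftInverse.injective (g := L) fun f => ?_
  have := RingHom.congr_fun hleft f
  simpa using this

/-- Peeling linear factors: if `E_j f = 0` for all `j ∈ S` (`E_j = substHom j g`, `g` fixed by the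
`E_j` and the `X_i`, `i ∈ S`, untouched by `E_j` for `j ≠ i`), then `∏_{j ∈ S} (X_j - g) ∣ f`. [folklore] -/
theorem prod_X_sub_dvd_of_substHom_eq_zero (g : MvPolynomial ℕ ℂ) (S : Finset ℕ)
    (hg : ∀ j ∈ S, substHom j g g = g) (hgX : ∀ j ∈ S, ∀ i ∈ S, i ≠ j → substHom j g (X i) = X i)
    (hg0 : ∀ j ∈ S, (X j : MvPolynomial ℕ ℂ) - g ≠ 0) :
    ∀ f : MvPolynomial ℕ ℂ, (∀ j ∈ S, substHom j g f = 0) → (∏ j ∈ S, (X j - g)) ∣ f := by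
  classical
  induction S using Finset.induction_on with
  | empty => intro f _; simp
  | insert a S haS ih =>
    intro f hf
    rw [Finset.prod_insert haS]
    obtain ⟨f₁, rfl⟩ := X_sub_dvd_of_substHom_eq_zero (hf a (Finset.mem_insert_self a S))
    refine mul_dvd_mul_left _ (ih (fun j hj => hg j (Finset.mem_insert_of_mem hj))
      (fun j hj i hi hij => hgX j (Finset.mem_insert_of_mem hj) i (Finset.mem_insert_of_mem hi) hij)
      (fun j hj => hg0 j (Finset.mem_insert_of_mem hj)) f₁ fun j hj => ?_)
    have hja : j ≠ a := fun h => haS (h ▸ hj)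
    have h := hf j (Finset.mem_insert_of_mem hj)
    rw [map_mul, map_sub, hgX j (Finset.mem_insert_of_mem hj) a (Finset.mem_insert_self a S) hja.symm,
      hg j (Finset.mem_insert_of_mem hj)] at h
    exact (mul_eq_zero.1 h).resolve_left (hg0 a (Finset.mem_insert_self a S))

/-- **The recursion scalar vanishes on every wheel hyperplane `z_j = q² z_1`, `3 ≤ j ≤ L`.** For a
polynomial `t`-fixed `P` at width `n+1` whose sum is invariant under the transpositions `(3 j)` and a
nonzero polynomial `t`-fixed `P''` at width `n`: since `Φ_k · η_1(Σ P) = η_1(P_k) · ẑ_1(Σ P'')`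
(IP12 (25) summed, up to the scalar) and `E_j η_1 (Σ P) = 0` (wheel), while `E_j ẑ_1 (Σ P'') ≠ 0`,
every numerator `η_1(P_k)` of the scalar is killed by `E_j : X_j ↦ q² X_1`.
[cite: IkhlefPonsaing2012, (25)–(27) and proof of Prop. 3.4] -/
theorem substHom_wheel_hypSubst_eq_zero {q : ℂ} (hq : q ^ 2 + q + 1 = 0)
    {P : ColPattern (n + 1) → MvPolynomial ℕ ℂ}
    (hP : ∀ Q', ∑ Q, ipTransferMatrixW (n + 1) (genC ℂ q) (genW ℂ) (genZ ℂ) Q Q' * toRF ℂ (P Q) = toRF ℂ (P Q'))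
    {P'' : ColPattern n → MvPolynomial ℕ ℂ} (hP''0 : P'' ≠ 0)
    (hP'' : ∀ Q', ∑ Q, ipTransferMatrixW n (genC ℂ q) (genW ℂ) (genZ ℂ) Q Q' * toRF ℂ (P'' Q) = toRF ℂ (P'' Q'))
    {j : ℕ} (hj : 3 ≤ j) (hsym : rename (Equiv.swap 3 j) (∑ Q, P Q) = ∑ Q, P Q) (k : ColPattern (n + 1)) :
    substHom j (C (q ^ 2) * X 1) (hypSubst q 1 (P k)) = 0 := by
  classical
  have hq0 : q ≠ 0 := q_ne_zero_of_quad hq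
  set Φ₁ : ColPattern (n + 1) → MvPolynomial ℕ ℂ := fun Q =>
    ∑ R ∈ Finset.univ.filter (fun R => cpInsDup 0 R = Q), hatRename 1 (P'' R) with hΦ₁
  -- (25) up to scalar, componentwise, then summed
  have I1 : ∀ Q, Φ₁ k * hypSubst q 1 (P Q) = hypSubst q 1 (P k) * Φ₁ Q := by
    intro Q
    have h := congrFun (groundState_hyp_recursion_odd hq (0 : Fin (n + 1)) hP hP'' k) Q
    simp only [Fin.val_zero, mul_zero, zero_add, Pi.smul_apply, smul_eq_mul] at h
    apply toRF_injective
    rw [map_mul, map_mul, hΦ₁]; simp only [map_sum]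
    exact h
  have Isum : Φ₁ k * hypSubst q 1 (∑ Q, P Q) = hypSubst q 1 (P k) * hatRename 1 (∑ R, P'' R) := by
    rw [map_sum, Finset.mul_sum, Finset.sum_congr rfl fun Q _ => I1 Q, ← Finset.mul_sum, map_sum]
    congr 1
    exact sum_fiber_total (fun R => cpInsDup 0 R) fun R => hatRename 1 (P'' R)
  -- wheel: `E_j η_1 (Σ P) = 0`
  have hwheel : substHom j (C (q ^ 2) * X 1) (hypSubst q 1 (∑ Q, P Q)) = 0 := by
    have h := groundState_sum_wheel hq hP hj hsym
    have e := RingHom.congr_fun (aeval_wheel_eq_substHom_comp_hypSubst q hj) (∑ Q, P Q)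
    simp only [AlgHom.toRingHom_eq_coe, RingHom.coe_coe, RingHom.comp_apply] at e
    rw [← e]; exact h
  -- apply `E_j` to the summed identity
  have h2 := congrArg (substHom j (C (q ^ 2) * X 1)) Isum
  rw [map_mul, map_mul, hwheel, mul_zero] at h2
  -- `E_j ẑ (Σ P'') ≠ 0`
  have hne : substHom j (C (q ^ 2) * X 1) (hatRename 1 (∑ R, P'' R)) ≠ 0 := by
    have hZ := groundState_sum_ne_zero hq hP''0 hP''
    intro h0
    apply hZ
    apply substHom_comp_hatRename_one_injective hq0 hj
    rw [map_zero]
    exact h0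
  exact (mul_eq_zero.1 h2.symm).resolve_right hne

/-- **Hence `∏_{3 ≤ j ≤ L} (X_j - q² X_1)` divides the numerator `η_1(P_k)` of the recursion scalar.**
[cite: IkhlefPonsaing2012, (25)–(27)] -/
theorem prod_wheel_dvd_hypSubst {q : ℂ} (hq : q ^ 2 + q + 1 = 0)
    {P : ColPattern (n + 1) → MvPolynomial ℕ ℂ}
    (hP : ∀ Q', ∑ Q, ipTransferMatrixW (n + 1) (genC ℂ q) (genW ℂ) (genZ ℂ) Q Q' * toRF ℂ (P Q) = toRF ℂ (P Q'))
    {P'' : ColPattern n → MvPolynomial ℕ ℂ} (hP''0 : P'' ≠ 0)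
    (hP'' : ∀ Q', ∑ Q, ipTransferMatrixW n (genC ℂ q) (genW ℂ) (genZ ℂ) Q Q' * toRF ℂ (P'' Q) = toRF ℂ (P'' Q'))
    (hsym : ∀ j, 3 ≤ j → j ≤ 2 * (n + 1) + 1 → rename (Equiv.swap 3 j) (∑ Q, P Q) = ∑ Q, P Q)
    (k : ColPattern (n + 1)) :
    (∏ j ∈ Finset.Icc 3 (2 * (n + 1) + 1), ((X j : MvPolynomial ℕ ℂ) - C (q ^ 2) * X 1)) ∣ hypSubst q 1 (P k) := by
  refine prod_X_sub_dvd_of_substHom_eq_zero (C (q ^ 2) * X 1) (Finset.Icc 3 (2 * (n + 1) + 1))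
    (fun j hj => ?_) (fun j hj i hi hij => ?_) (fun j hj h0 => ?_) (hypSubst q 1 (P k)) (fun j hj => ?_)
  · rw [Finset.mem_Icc] at hj
    rw [map_mul, substHom_C, substHom_X_of_ne _ (show (1 : ℕ) ≠ j by omega)]
  · exact substHom_X_of_ne _ hij
  · rw [Finset.mem_Icc] at hj
    have := congrArg (eval fun i : ℕ => if i = j then (1 : ℂ) else 0) h0
    simp only [map_sub, map_mul, eval_X, eval_C, map_zero] at this
    rw [if_neg (show (1 : ℕ) ≠ j by omega)] at this
    norm_num at this
  · rw [Finset.mem_Icc] at hj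
    exact substHom_wheel_hypSubst_eq_zero hq hP hP''0 hP'' hj.1 (hsym j hj.1 hj.2) k

end ScalarRoots

end Literature.Probability.Percolation
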